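import Summits.Parity.GeneralizedHardyLittlewood.Theorems.PrimeLevelFamEdgeMomentsBeyondDiagonalDiagRemP2MoebiusAsymp
import Summits.Parity.GeneralizedHardyLittlewood.Theorems.PrimeLevelFamEdgeMomentsBeyondDiagonalDiagRemP2HyperbolaTools
import Summits.Parity.GeneralizedHardyLittlewood.Theorems.PrimeLevelFamEdgeMomentsBeyondDiagonalDiagRemInner
import HarnessLib

/-!
# Route `PrimeLevelFamEdge`, crux K_A `MomentsBeyondDiagonal` (stmt-Parity-20007), line «petersson_layers» v4, stub `stub_diag`:
# **`Σ_{de ≤ z} μ(d)P₂(d)μ(e)/(de) = −1 + O((1+log z)⁻ⁿ)`** (L4 of the (P2TAIL) chain: the hyperbola step)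

Fourth brick of the ONE new analytic input (P2TAIL) of the order-`(2,2)` remainder estimate of `stub_diag` (plan:
`Cruxes/MomentsBeyondDiagonal/Lines/petersson_layers_stub_diag_g12_R02_R22.md`). With `f = μP₂/id`
(`Σ_{d ≤ y} f(d) = −log y + c_F + O((log y)⁻ⁿ)`, `…DiagRemP2MoebiusAsymp`) and `g = μ/id` (`m(y) = Σ_{e ≤ y} g(e) ≪ e^{−c√log y}`,
`Σ_{e ≤ y} μ(e)log e/e = −1 + O(e^{−c√log y})`, tree), Dirichlet's hyperbola method at `u = ⌊√z⌋` gives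
`N(z) = Σ_{d ≤ u} f(d)m(z/d) + Σ_{e ≤ u} g(e)(F(z/e) − F(√z)) = o(1) + (Σ_{e≤u} μ(e)log e/e − ½log z·m(√z) + o(1)) = −1 + o(1)`.
This `−1` is the value at `w = 0` of the generating function `−ζ(1+w)⁻²Σ_p log²p/(p^{1+w}−1)` of `(μP₂/id) ∗ (μ/id)`; it is the
constant that makes the `P₂`-decorated Selberg coefficients converge (`c_n = −2Σ_m h_n(m)` in L5).

Tools: `Σ_{k≤Y} τ(k)P₂(k)/k ≤ (1+log Y)⁴` is `…DiagRemInner.sum_tau_div_primeSq_ellp_pow_le`; the general hyperbola identity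
`sum_hyperbola_asym` is in `…DiagRemP2HyperbolaTools`.

* `sum_moebius_primeSq_hyperbola_asymp_of` — **for every `n` there is `K` with
  `|Σ_{d ≤ z}Σ_{e ≤ z/d} μ(d)P₂(d)/d·μ(e)/e + 1| ≤ K/(1 + log z)ⁿ` for all `z ≥ 1`** (from the Goldston–Yıldırım fact
  `goldstonYildirim_lemma21_j0`, PROVED in the tree, carried as a hypothesis as in L3).

Def-free; theorems only; classical. Helper `--supports stmt-Parity-20007`; closes nothing; K_A, K_B and the Parity summit are NOT
proved; nothing about Landau–Siegel zeros.

## References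
* H. L. Montgomery, R. C. Vaughan, *Multiplicative Number Theory I*, CUP 2007, §2.1 (hyperbola method) and §8.1.
  [cite: MontgomeryVaughan2007, §8.1 — derivation]
-/

noncomputable section

open Finset Real
open scoped ArithmeticFunction.Moebius

namespace Summit.Parity.GeneralizedHardyLittlewood.Theorems.MomentsBeyondDiagonal.DiagCorner

open Literature.NumberTheory.Sieve (goldstonYildirim_lemma21_j0)
open Literature.NumberTheory.Sieve.GreenTao2008
open Literature.NumberTheory.LFunctions.MoebiusLogSum
open Summit.Parity.GeneralizedHardyLittlewood.Theorems.BeyondDiagonalBeatsQuarter.Corner (ellp)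
set_option maxHeartbeats 800000 in
/-- **`Σ_{de ≤ z} μ(d)P₂(d)μ(e)/(de) = −1 + O((1 + log z)⁻ⁿ)`** (every `n`, all `z ≥ 1`), from the Goldston–Yıldırım fact
`goldstonYildirim_lemma21_j0` (PROVED in the tree). [cite: MontgomeryVaughan2007, §8.1 — derivation] -/
theorem sum_moebius_primeSq_hyperbola_asymp_of (hGY : goldstonYildirim_lemma21_j0) (n : ℕ) :
    ∃ K : ℝ, ∀ z : ℝ, 1 ≤ z →
      |(∑ d ∈ Icc 1 ⌊z⌋₊, ∑ e ∈ Icc 1 (⌊z⌋₊ / d),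
          (ArithmeticFunction.moebius d : ℝ) / d * (∑ p ∈ d.primeFactors, Real.log p ^ 2) *
            ((ArithmeticFunction.moebius e : ℝ) / e)) + 1| ≤ K / (1 + Real.log z) ^ n := by
  -- inputs
  obtain ⟨cF, hF⟩ := sum_moebius_primeSq_div_asymp_of hGY
  obtain ⟨KF, hKF⟩ := hF (n + 1)
  obtain ⟨c₀, hc₀, C₀, hC₀0, hm⟩ := exists_abs_moebiusHarmonic_le
  obtain ⟨c₂, hc₂, C₂, hML⟩ := Literature.NumberTheory.LFunctions.abs_sum_moebius_mul_log_div_add_one_le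
  obtain ⟨E₀, hE₀0, hE₀⟩ := exp_neg_sqrt_half_le_div_pow hc₀ (n + 4)
  obtain ⟨E₂, hE₂0, hE₂⟩ := exp_neg_sqrt_half_le_div_pow hc₂ n
  have hKF0 : 0 ≤ KF := by
    have h := hKF 4 le_rfl
    have hl : 0 < Real.log 4 := Real.log_pos (by norm_num)
    have h0 : 0 ≤ KF / Real.log 4 ^ (n + 1) := (abs_nonneg _).trans h
    by_contra hneg
    have : KF / Real.log 4 ^ (n + 1) < 0 := div_neg_of_neg_of_pos (not_le.mp hneg) (pow_pos hl _)
    linarith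
  have hC₂0 : 0 ≤ C₂ := by
    have h := hML 2 le_rfl
    have h0 : 0 ≤ C₂ * Real.exp (-c₂ * Real.sqrt (Real.log 2)) := (abs_nonneg _).trans h
    by_contra hneg
    have : C₂ * Real.exp (-c₂ * Real.sqrt (Real.log 2)) < 0 := mul_neg_of_neg_of_pos (not_le.mp hneg) (Real.exp_pos _)
    linarith
  -- the constant: large `z` part times `2ⁿ`, plus the small-`z` patch
  set Kbig : ℝ := 17 * C₀ * E₀ + 2 ^ (n + 3) * KF + C₂ * E₂ with hKbig
  have hKbig0 : 0 ≤ Kbig := by positivity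
  refine ⟨2 ^ n * Kbig + 4000 * 4 ^ n, fun z hz ↦ ?_⟩
  have hz0 : 0 < z := by linarith
  set L : ℝ := Real.log z with hLdef
  have hL0 : 0 ≤ L := Real.log_nonneg hz
  set Z : ℕ := ⌊z⌋₊ with hZdef
  -- the summand, abbreviated
  set f : ℕ → ℝ := fun d ↦ (ArithmeticFunction.moebius d : ℝ) / d * ∑ p ∈ d.primeFactors, Real.log p ^ 2 with hfdef
  set g : ℕ → ℝ := fun e ↦ (ArithmeticFunction.moebius e : ℝ) / e with hgdef
  have habsf : ∀ d : ℕ, d ≠ 0 →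
      |f d| ≤ (d.divisors.card : ℝ) / d * (∑ p ∈ d.primeFactors, Real.log p ^ 2) := by
    intro d hd
    have hd0 : (0 : ℝ) < d := by exact_mod_cast Nat.pos_of_ne_zero hd
    have hP : 0 ≤ ∑ p ∈ d.primeFactors, Real.log p ^ 2 := Finset.sum_nonneg fun _ _ ↦ sq_nonneg _
    rw [hfdef]; dsimp only
    rw [abs_mul, abs_of_nonneg hP, abs_div, abs_of_pos hd0]
    have hμ : |(ArithmeticFunction.moebius d : ℝ)| ≤ 1 := by exact_mod_cast ArithmeticFunction.abs_moebius_le_one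
    have hτ : (1 : ℝ) ≤ d.divisors.card := by
      exact_mod_cast Finset.card_pos.2 ⟨1, Nat.one_mem_divisors.2 hd⟩
    gcongr
    exact hμ.trans hτ
  have habsg : ∀ e : ℕ, e ≠ 0 → |g e| ≤ (e : ℝ)⁻¹ := by
    intro e he
    have he0 : (0 : ℝ) < e := by exact_mod_cast Nat.pos_of_ne_zero he
    rw [hgdef]; dsimp only
    rw [abs_div, abs_of_pos he0, div_eq_mul_inv]
    have hμ : |(ArithmeticFunction.moebius e : ℝ)| ≤ 1 := by exact_mod_cast ArithmeticFunction.abs_moebius_le_one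
    exact mul_le_of_le_one_left (by positivity) hμ
  have hsum_eq : ∑ d ∈ Icc 1 Z, ∑ e ∈ Icc 1 (Z / d),
      (ArithmeticFunction.moebius d : ℝ) / d * (∑ p ∈ d.primeFactors, Real.log p ^ 2) *
        ((ArithmeticFunction.moebius e : ℝ) / e) = ∑ d ∈ Icc 1 Z, ∑ e ∈ Icc 1 (Z / d), f d * g e := rfl
  rw [hsum_eq]
  rcases lt_or_ge z 16 with hz16 | hz16
  · ------------------------------------------------------------
    -- small `z`: a trivial bound
    ------------------------------------------------------------
    have hZ15 : Z ≤ 15 := by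
      have : Z < 16 := (Nat.floor_lt hz0.le).2 (by exact_mod_cast hz16)
      omega
    have hl16 : Real.log 16 < 2.8 := by
      have h : Real.log 16 = 4 * Real.log 2 := by
        rw [show (16 : ℝ) = 2 ^ 4 by norm_num, Real.log_pow]; norm_num
      have := Real.log_two_lt_d9; rw [h]; linarith
    have hLle : L ≤ Real.log 16 := Real.log_le_log hz0 hz16.le
    have hterm : ∀ d ∈ Icc 1 Z, |∑ e ∈ Icc 1 (Z / d), f d * g e| ≤
        (d.divisors.card : ℝ) / d * (∑ p ∈ d.primeFactors, Real.log p ^ 2) * ellp z d ^ 0 * 15 := by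
      intro d hd
      have hd1 : 1 ≤ d := (Finset.mem_Icc.1 hd).1
      rw [pow_zero, mul_one, ← Finset.mul_sum, abs_mul]
      refine mul_le_mul (habsf d (by omega)) ?_ (abs_nonneg _) (by positivity)
      calc |∑ e ∈ Icc 1 (Z / d), g e| ≤ ∑ e ∈ Icc 1 (Z / d), |g e| := Finset.abs_sum_le_sum_abs _ _
        _ ≤ ∑ e ∈ Icc 1 (Z / d), (1 : ℝ) := Finset.sum_le_sum fun e he ↦ by
            have he1 : 1 ≤ e := (Finset.mem_Icc.1 he).1
            exact (habsg e (by omega)).trans (by rw [inv_le_one_iff₀]; right; exact_mod_cast he1)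
        _ = (Z / d : ℕ) := by simp
        _ ≤ 15 := by exact_mod_cast (Nat.div_le_self Z d).trans hZ15
    have hN : |∑ d ∈ Icc 1 Z, ∑ e ∈ Icc 1 (Z / d), f d * g e| ≤ 4 ^ 4 * 15 := by
      have hS := sum_tau_div_primeSq_ellp_pow_le 0 hz
      rw [pow_zero, one_mul, ← hZdef] at hS
      have h14 : (1 + L) ^ 4 ≤ 4 ^ 4 := pow_le_pow_left₀ (by positivity) (by linarith) 4
      calc _ ≤ ∑ d ∈ Icc 1 Z, |∑ e ∈ Icc 1 (Z / d), f d * g e| := Finset.abs_sum_le_sum_abs _ _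
        _ ≤ ∑ d ∈ Icc 1 Z, (d.divisors.card : ℝ) / d * (∑ p ∈ d.primeFactors, Real.log p ^ 2) * ellp z d ^ 0 * 15 :=
            Finset.sum_le_sum hterm
        _ = (∑ d ∈ Icc 1 Z, (d.divisors.card : ℝ) / d * (∑ p ∈ d.primeFactors, Real.log p ^ 2) * ellp z d ^ 0) * 15 := by
            rw [Finset.sum_mul]
        _ ≤ (1 + L) ^ 4 * 15 := mul_le_mul_of_nonneg_right hS (by norm_num)
        _ ≤ 4 ^ 4 * 15 := mul_le_mul_of_nonneg_right h14 (by norm_num)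
    have h4 : (1 + L) ^ n ≤ 4 ^ n := pow_le_pow_left₀ (by positivity) (by linarith) n
    have hpos : 0 < (1 + L) ^ n := by positivity
    calc |∑ d ∈ Icc 1 Z, ∑ e ∈ Icc 1 (Z / d), f d * g e + 1|
        ≤ |∑ d ∈ Icc 1 Z, ∑ e ∈ Icc 1 (Z / d), f d * g e| + |(1 : ℝ)| := abs_add_le _ _
      _ ≤ 4000 := by rw [abs_one]; norm_num at hN ⊢; linarith
      _ = 4000 * 4 ^ n / 4 ^ n := by field_simp
      _ ≤ 4000 * 4 ^ n / (1 + L) ^ n := div_le_div_of_nonneg_left (by positivity) hpos h4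
      _ ≤ (2 ^ n * Kbig + 4000 * 4 ^ n) / (1 + L) ^ n := by
          apply div_le_div_of_nonneg_right _ hpos.le
          have : 0 ≤ 2 ^ n * Kbig := by positivity
          linarith
  ------------------------------------------------------------
  -- large `z ≥ 16`
  ------------------------------------------------------------
  have hz1 : 1 < z := by linarith
  have hL16 : Real.log 16 ≤ L := Real.log_le_log (by norm_num) hz16
  have hlog16 : 2 < Real.log 16 := by
    have h : Real.log 16 = 4 * Real.log 2 := by
      rw [show (16 : ℝ) = 2 ^ 4 by norm_num, Real.log_pow]; norm_num
    have := Real.log_two_gt_d9; rw [h]; linarith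
  have hL2 : 2 ≤ L := by linarith
  have hL1 : 1 ≤ L := by linarith
  have hLpos : 0 < L := by linarith
  set s : ℝ := Real.sqrt z with hsdef
  have hs4 : 4 ≤ s := by
    rw [hsdef, show (4 : ℝ) = Real.sqrt 16 by
      rw [show (16 : ℝ) = 4 ^ 2 by norm_num, Real.sqrt_sq (by norm_num)]]
    exact Real.sqrt_le_sqrt hz16
  have hs0 : 0 < s := by linarith
  have hs2 : 2 ≤ s := by linarith
  have hss : s * s = z := Real.mul_self_sqrt hz0.le
  have hlogs : Real.log s = L / 2 := by rw [hsdef, Real.log_sqrt hz0.le]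
  set u : ℕ := ⌊s⌋₊ with hudef
  have hus : (u : ℝ) ≤ s := Nat.floor_le hs0.le
  have hsu : s < (u : ℝ) + 1 := Nat.lt_floor_add_one s
  have hu4 : 4 ≤ u := Nat.le_floor (by simpa using hs4)
  have hu1 : 1 ≤ u := by omega
  have hu0 : (0 : ℝ) < u := by exact_mod_cast (by omega : 0 < u)
  have huu : u * u ≤ Z := by
    refine Nat.le_floor ?_
    push_cast
    calc (u : ℝ) * u ≤ s * s := mul_le_mul hus hus hu0.le hs0.le
      _ = z := hss
  have hZu : Z < (u + 1) * (u + 1) := by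
    refine (Nat.floor_lt hz0.le).2 ?_
    push_cast
    calc z = s * s := hss.symm
      _ < ((u : ℝ) + 1) * ((u : ℝ) + 1) := mul_lt_mul'' hsu hsu hs0.le hs0.le
  have hlogu : Real.log u ≤ L / 2 := by rw [← hlogs]; exact Real.log_le_log hu0 hus
  have hlogu0 : 0 ≤ Real.log u := Real.log_nonneg (by exact_mod_cast hu1)
  -- exponentials at `L/2`
  have hexp : ∀ {c x : ℝ}, 0 < c → s ≤ x →
      Real.exp (-(c * Real.sqrt (Real.log x))) ≤ Real.exp (-(c * Real.sqrt (L / 2))) := by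
    intro c x hc hx
    apply Real.exp_le_exp.2
    have : Real.sqrt (L / 2) ≤ Real.sqrt (Real.log x) := by
      rw [← hlogs]; exact Real.sqrt_le_sqrt (Real.log_le_log hs0 hx)
    nlinarith
  -- for `d ≤ u`: `z/d ≥ s`
  have hzd : ∀ d ∈ Icc 1 u, s ≤ z / d ∧ ⌊z / d⌋₊ = Z / d := by
    intro d hd
    have hd1 : 1 ≤ d := (Finset.mem_Icc.1 hd).1
    have hdu : (d : ℝ) ≤ u := by exact_mod_cast (Finset.mem_Icc.1 hd).2
    have hd0 : (0 : ℝ) < d := by exact_mod_cast hd1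
    refine ⟨?_, by rw [hZdef]; exact Nat.floor_div_natCast z d⟩
    rw [le_div_iff₀ hd0, ← hss]
    exact mul_le_mul_of_nonneg_left (hdu.trans hus) hs0.le
  -- the hyperbola split
  rw [sum_hyperbola_asym (fun d e ↦ f d * g e) huu hZu]
  ------------------------------------------------------------
  -- part (i): `Σ_{d ≤ u} f(d) m(z/d)`
  ------------------------------------------------------------
  have hm_eq : ∀ d ∈ Icc 1 u, ∑ e ∈ Icc 1 (Z / d), f d * g e = f d * moebiusHarmonic (z / d) := by
    intro d hd
    rw [← Finset.mul_sum, moebiusHarmonic_def, (hzd d hd).2]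
  have hpart1 : |∑ d ∈ Icc 1 u, ∑ e ∈ Icc 1 (Z / d), f d * g e| ≤ 16 * C₀ * E₀ / L ^ n := by
    have hterm : ∀ d ∈ Icc 1 u, |∑ e ∈ Icc 1 (Z / d), f d * g e| ≤
        (d.divisors.card : ℝ) / d * (∑ p ∈ d.primeFactors, Real.log p ^ 2) * ellp s d ^ 0 *
          (C₀ * Real.exp (-(c₀ * Real.sqrt (L / 2)))) := by
      intro d hd
      have hd1 : 1 ≤ d := (Finset.mem_Icc.1 hd).1
      rw [hm_eq d hd, abs_mul, pow_zero, mul_one]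
      have h2 : |moebiusHarmonic (z / d)| ≤ C₀ * Real.exp (-(c₀ * Real.sqrt (L / 2))) :=
        (hm (z / d) (hs2.trans (hzd d hd).1)).trans (mul_le_mul_of_nonneg_left (hexp hc₀ (hzd d hd).1) hC₀0)
      exact mul_le_mul (habsf d (by omega)) h2 (abs_nonneg _) (by positivity)
    have hS := sum_tau_div_primeSq_ellp_pow_le 0 (by linarith : (1 : ℝ) ≤ s)
    rw [pow_zero, one_mul, ← hudef, hlogs] at hS
    have h14 : (1 + L / 2) ^ 4 ≤ (2 * L) ^ 4 := pow_le_pow_left₀ (by positivity) (by linarith) 4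
    calc _ ≤ ∑ d ∈ Icc 1 u, (d.divisors.card : ℝ) / d * (∑ p ∈ d.primeFactors, Real.log p ^ 2) * ellp s d ^ 0 *
          (C₀ * Real.exp (-(c₀ * Real.sqrt (L / 2)))) :=
          (Finset.abs_sum_le_sum_abs _ _).trans (Finset.sum_le_sum hterm)
      _ = (∑ d ∈ Icc 1 u, (d.divisors.card : ℝ) / d * (∑ p ∈ d.primeFactors, Real.log p ^ 2) * ellp s d ^ 0) *
          (C₀ * Real.exp (-(c₀ * Real.sqrt (L / 2)))) := by rw [Finset.sum_mul]
      _ ≤ (2 * L) ^ 4 * (C₀ * (E₀ / L ^ (n + 4))) := by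
          refine mul_le_mul (hS.trans h14) ?_ (by positivity) (by positivity)
          exact mul_le_mul_of_nonneg_left (hE₀ L hL1) hC₀0
      _ = 16 * C₀ * E₀ / L ^ n := by rw [pow_add, mul_pow]; field_simp; ring
  ------------------------------------------------------------
  -- part (ii): `Σ_{e ≤ u} g(e)(F(z/e) − F(√z))`
  ------------------------------------------------------------
  -- `F` at `z/e` and at `s`
  have hFs := hKF s hs4
  rw [← hudef, hlogs] at hFs
  have hinner : ∀ e ∈ Icc 1 u, ∑ d ∈ Ioc u (Z / e), f d * g e =
      g e * (((∑ d ∈ Icc 1 (Z / e), f d) + Real.log (z / e) - cF) -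
        ((∑ d ∈ Icc 1 u, f d) + L / 2 - cF)) + (g e * Real.log e - L / 2 * g e) := by
    intro e he
    have he1 : 1 ≤ e := (Finset.mem_Icc.1 he).1
    have he0 : (0 : ℝ) < e := by exact_mod_cast he1
    have heu : e ≤ u := (Finset.mem_Icc.1 he).2
    have hsmall : u ≤ Z / e := (Nat.le_div_iff_mul_le he1).2 (le_trans (Nat.mul_le_mul_left u heu) huu)
    have hcons : ∑ d ∈ Ioc u (Z / e), f d = (∑ d ∈ Icc 1 (Z / e), f d) - ∑ d ∈ Icc 1 u, f d := by
      rw [Literature.Barriers.Parity.Icc_one_eq_Ioc_zero, Literature.Barriers.Parity.Icc_one_eq_Ioc_zero,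
        ← Finset.sum_Ioc_consecutive _ (Nat.zero_le u) hsmall]
      ring
    rw [← Finset.sum_mul, hcons, Real.log_div hz0.ne' he0.ne']
    ring
  have herr : ∀ e ∈ Icc 1 u, |g e * (((∑ d ∈ Icc 1 (Z / e), f d) + Real.log (z / e) - cF) -
        ((∑ d ∈ Icc 1 u, f d) + L / 2 - cF))| ≤ (e : ℝ)⁻¹ * (2 ^ (n + 2) * KF / L ^ (n + 1)) := by
    intro e he
    have he1 : 1 ≤ e := (Finset.mem_Icc.1 he).1
    obtain ⟨hze, hfl⟩ := hzd e he
    have h1 := hKF (z / e) (hs4.trans hze)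
    rw [hfl] at h1
    have hpow : ∀ {x : ℝ}, s ≤ x → KF / Real.log x ^ (n + 1) ≤ 2 ^ (n + 1) * KF / L ^ (n + 1) := by
      intro x hx
      have hlx : L / 2 ≤ Real.log x := by rw [← hlogs]; exact Real.log_le_log hs0 hx
      have hL2' : 0 < L / 2 := by positivity
      calc KF / Real.log x ^ (n + 1) ≤ KF / (L / 2) ^ (n + 1) := by
            apply div_le_div_of_nonneg_left hKF0 (pow_pos hL2' _)
            exact pow_le_pow_left₀ hL2'.le hlx _
        _ = 2 ^ (n + 1) * KF / L ^ (n + 1) := by rw [div_pow]; field_simp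
    have e1 := h1.trans (hpow hze)
    have e2 : |(∑ d ∈ Icc 1 u, f d) + L / 2 - cF| ≤ 2 ^ (n + 1) * KF / L ^ (n + 1) := by
      refine hFs.trans ?_
      have := hpow (le_refl s)
      rwa [hlogs] at this
    rw [abs_mul]
    refine mul_le_mul (habsg e (by omega)) ?_ (abs_nonneg _) (by positivity)
    have h22 : (2 : ℝ) ^ (n + 2) * KF / L ^ (n + 1) = 2 ^ (n + 1) * KF / L ^ (n + 1) + 2 ^ (n + 1) * KF / L ^ (n + 1) := by
      ring
    rw [h22]
    exact (abs_sub _ _).trans (add_le_add e1 e2)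
  have hpart2_split : ∑ e ∈ Icc 1 u, ∑ d ∈ Ioc u (Z / e), f d * g e =
      (∑ e ∈ Icc 1 u, g e * (((∑ d ∈ Icc 1 (Z / e), f d) + Real.log (z / e) - cF) -
        ((∑ d ∈ Icc 1 u, f d) + L / 2 - cF))) +
      ((∑ e ∈ Icc 1 u, (ArithmeticFunction.moebius e : ℝ) * Real.log e / e) - L / 2 * moebiusHarmonic s) := by
    rw [Finset.sum_congr rfl hinner, Finset.sum_add_distrib, Finset.sum_sub_distrib, ← Finset.mul_sum,
      moebiusHarmonic_def, ← hudef]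
    congr 2
    refine Finset.sum_congr rfl fun e _ ↦ ?_
    rw [hgdef]; dsimp only; ring
  have herrsum : |∑ e ∈ Icc 1 u, g e * (((∑ d ∈ Icc 1 (Z / e), f d) + Real.log (z / e) - cF) -
        ((∑ d ∈ Icc 1 u, f d) + L / 2 - cF))| ≤ 2 ^ (n + 3) * KF / L ^ n := by
    have hharm := sum_Icc_inv_le_one_add_log' hu1
    calc _ ≤ ∑ e ∈ Icc 1 u, (e : ℝ)⁻¹ * (2 ^ (n + 2) * KF / L ^ (n + 1)) :=
          (Finset.abs_sum_le_sum_abs _ _).trans (Finset.sum_le_sum herr)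
      _ = (∑ e ∈ Icc 1 u, (e : ℝ)⁻¹) * (2 ^ (n + 2) * KF / L ^ (n + 1)) := by rw [Finset.sum_mul]
      _ ≤ (2 * L) * (2 ^ (n + 2) * KF / L ^ (n + 1)) := by
          have : 1 + Real.log u ≤ 2 * L := by linarith
          exact mul_le_mul_of_nonneg_right (hharm.trans this) (by positivity)
      _ = 2 ^ (n + 3) * KF / L ^ n := by rw [pow_succ L n]; field_simp; ring
  have hlogsum : |(∑ e ∈ Icc 1 u, (ArithmeticFunction.moebius e : ℝ) * Real.log e / e) + 1| ≤ C₂ * E₂ / L ^ n := by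
    have h := hML s hs2
    rw [← hudef, neg_mul] at h
    refine h.trans ?_
    calc C₂ * Real.exp (-(c₂ * Real.sqrt (Real.log s))) ≤ C₂ * Real.exp (-(c₂ * Real.sqrt (L / 2))) :=
          mul_le_mul_of_nonneg_left (hexp hc₂ le_rfl) hC₂0
      _ ≤ C₂ * (E₂ / L ^ n) := mul_le_mul_of_nonneg_left (hE₂ L hL1) hC₂0
      _ = C₂ * E₂ / L ^ n := by ring
  have hmterm : |L / 2 * moebiusHarmonic s| ≤ C₀ * E₀ / L ^ n := by
    rw [abs_mul, abs_of_nonneg (by positivity : 0 ≤ L / 2)]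
    calc L / 2 * |moebiusHarmonic s| ≤ L / 2 * (C₀ * Real.exp (-(c₀ * Real.sqrt (Real.log s)))) :=
          mul_le_mul_of_nonneg_left (hm s hs2) (by positivity)
      _ ≤ L / 2 * (C₀ * (E₀ / L ^ (n + 4))) := by
          gcongr
          exact (hexp hc₀ le_rfl).trans (hE₀ L hL1)
      _ = C₀ * E₀ / L ^ n / (2 * L ^ 3) := by rw [pow_add]; field_simp
      _ ≤ C₀ * E₀ / L ^ n := by
          apply div_le_self (by positivity)
          nlinarith [pow_le_pow_left₀ zero_le_one hL1 3]
  -- assembly for `z ≥ 16`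
  rw [hpart2_split]
  have hid : ∑ d ∈ Icc 1 u, ∑ e ∈ Icc 1 (Z / d), f d * g e +
      ((∑ e ∈ Icc 1 u, g e * (((∑ d ∈ Icc 1 (Z / e), f d) + Real.log (z / e) - cF) -
        ((∑ d ∈ Icc 1 u, f d) + L / 2 - cF))) +
      ((∑ e ∈ Icc 1 u, (ArithmeticFunction.moebius e : ℝ) * Real.log e / e) - L / 2 * moebiusHarmonic s)) + 1 =
      ∑ d ∈ Icc 1 u, ∑ e ∈ Icc 1 (Z / d), f d * g e +
      (∑ e ∈ Icc 1 u, g e * (((∑ d ∈ Icc 1 (Z / e), f d) + Real.log (z / e) - cF) -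
        ((∑ d ∈ Icc 1 u, f d) + L / 2 - cF))) +
      ((∑ e ∈ Icc 1 u, (ArithmeticFunction.moebius e : ℝ) * Real.log e / e) + 1) - L / 2 * moebiusHarmonic s := by
    ring
  rw [hid]
  have hLn : Kbig / L ^ n ≤ (2 ^ n * Kbig + 4000 * 4 ^ n) / (1 + L) ^ n := by
    have h1 : (1 + L) ^ n ≤ (2 * L) ^ n := pow_le_pow_left₀ (by positivity) (by linarith) n
    have hLn0 : 0 < L ^ n := by positivity
    calc Kbig / L ^ n = 2 ^ n * Kbig / (2 * L) ^ n := by rw [mul_pow]; field_simp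
      _ ≤ 2 ^ n * Kbig / (1 + L) ^ n := div_le_div_of_nonneg_left (by positivity) (by positivity) h1
      _ ≤ (2 ^ n * Kbig + 4000 * 4 ^ n) / (1 + L) ^ n := by
          apply div_le_div_of_nonneg_right _ (by positivity)
          have : (0 : ℝ) ≤ 4000 * 4 ^ n := by positivity
          linarith
  refine le_trans ?_ hLn
  calc _ ≤ |∑ d ∈ Icc 1 u, ∑ e ∈ Icc 1 (Z / d), f d * g e| +
      |∑ e ∈ Icc 1 u, g e * (((∑ d ∈ Icc 1 (Z / e), f d) + Real.log (z / e) - cF) -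
        ((∑ d ∈ Icc 1 u, f d) + L / 2 - cF))| +
      |(∑ e ∈ Icc 1 u, (ArithmeticFunction.moebius e : ℝ) * Real.log e / e) + 1| + |L / 2 * moebiusHarmonic s| := by
        refine (abs_sub _ _).trans (add_le_add ((abs_add_le _ _).trans (add_le_add (abs_add_le _ _) le_rfl)) le_rfl)
    _ ≤ 16 * C₀ * E₀ / L ^ n + 2 ^ (n + 3) * KF / L ^ n + C₂ * E₂ / L ^ n + C₀ * E₀ / L ^ n :=
        add_le_add (add_le_add (add_le_add hpart1 herrsum) hlogsum) hmterm
    _ = Kbig / L ^ n := by rw [hKbig]; ring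

end Summit.Parity.GeneralizedHardyLittlewood.Theorems.MomentsBeyondDiagonal.DiagCorner

end
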